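import Literature.MathematicalPhysics.QuantumLattice.LiebWuBetheAnsatz
import Literature.Analysis.FunctionSpaces.LiebWuChargeGapProofs
import HarnessLib

/-!
# hubbard.S10, Mott-insulator half: `lieb_wu_mott_insulator` reduced to Lieb–Wu's `μ₋`

Family `hubbard` (trunk T-QLATTICE). Sibling proof file of
`Literature/MathematicalPhysics/QuantumLattice/HubbardHubbardModel.lean` for the named fact
`Literature.MathematicalPhysics.QuantumLattice.lieb_wu_mott_insulator` (for every `U > 0`: the Lieb–Wu charge gap
`Δ(U) = U - 4 + 8 ∫₀^∞ J₁(ω)/(ω(1 + e^{ωU/2})) dω` is positive, and the charge gaps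
`E(2n+1) + E(2n-1) - 2E(2n)` of the half-filled Hubbard rings of even length `2n`, `t = 1`, are
eventually `> Δ(U)/2`; Lieb–Wu, PRL 20 (1968) 1445, eqs. (21)–(23) and the discussion following
(23): "`μ₊ > μ₋` for `U > 0` … there is no Mott transition for nonzero `U`").

`HubbardHubbardModel.lean` proves the assembly `lieb_wu_mott_insulator_of : lieb_wu →
liebWuChargeGap_pos → lieb_wu_mott_insulator`. Since then
* the analytic input `liebWuChargeGap_pos` has been PROVED
  (`Literature/Analysis/FunctionSpaces/LiebWuChargeGapProofs.lean`,
  `liebWuChargeGap_pos_holds`), and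
* `lieb_wu` has been decomposed along the printed Bethe-ansatz derivation
  (`LiebWuBetheAnsatz.lean`): its charge-gap half follows from particle–hole symmetry (F5a,
  proved: `hubbardChain_groundEnergyAt_particleHole_holds`) and Lieb–Wu's formula for the energy
  to remove one electron, `E(2n) - E(2n-1) → μ₋(U) = 2 - 4 ∫₀^∞ J₁/(ω(1 + e^{ωU/2}))` (F5b,
  `liebWu_muMinus_tendsto`, a named fact WITHOUT printed proof: Lieb–Wu 2003, §7, derive it only
  formally, see the module docstring of `LiebWuBetheAnsatz.lean`).

This file records the resulting reductions, all sorry-free: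
`lieb_wu_mott_insulator_of_lieb_wu : lieb_wu → lieb_wu_mott_insulator` and
`lieb_wu_mott_insulator_of_muMinus_tendsto : liebWu_muMinus_tendsto → lieb_wu_mott_insulator`
— the Mott-insulator statement now rests on the single physics-level input F5b —, the variant
`lieb_wu_mott_insulator_of_tendsto_chargeGap` (any proof of the convergence of the charge gaps
suffices) and the unconditional first half `lieb_wu_mott_insulator_gap`.

## References

* E. H. Lieb, F. Y. Wu, PRL 20 (1968) 1445, eqs. (21)–(23) and the following discussion
  (key `LiebWuPRL1968`; read in the reprint volume A. Montorsi (ed.), *The Hubbard Model*, World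
  Scientific 1992, pp. 63–69 of the held PDF).
* E. H. Lieb, F. Y. Wu, Physica A 321 (2003) 1 = arXiv:cond-mat/0207529, §7 (key
  `LiebWuPhysicaA2003`).
-/

noncomputable section

namespace Literature.MathematicalPhysics.QuantumLattice

open Filter
open scoped Topology

/-- **`lieb_wu_mott_insulator` from `lieb_wu` alone**: the positivity of the Lieb–Wu gap being
proved (`liebWuChargeGap_pos_holds`), the Mott-insulator statement follows from the Lieb–Wu limits
`lieb_wu` (indeed from its charge-gap half only, see `lieb_wu_mott_insulator_of_muMinus_tendsto`).
Lieb–Wu, PRL 20 (1968) 1445, discussion after eq. (23).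
[cite: LiebWuPRL1968, discussion after eq. (23)] -/
theorem lieb_wu_mott_insulator_of_lieb_wu (hLW : lieb_wu) : lieb_wu_mott_insulator :=
  lieb_wu_mott_insulator_of hLW Literature.Analysis.FunctionSpaces.liebWuChargeGap_pos_holds

/-- **`lieb_wu_mott_insulator` from Lieb–Wu's `μ₋` alone** (node F5b of `LiebWuBetheAnsatz`):
if `E(2n) - E(2n-1) → μ₋(U)` along the half-filled even rings, then by particle–hole symmetry
(`E(2n+1) = E(2n-1) + U`, proved) the charge gaps tend to `U - 2μ₋(U) = Δ(U)`
(`lieb_wu_chargeGap_of`), which is `> 0` (`liebWuChargeGap_pos_holds`), so they are eventually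
`> Δ(U)/2`. Lieb–Wu, PRL 20 (1968) 1445, eqs. (21)–(23); Physica A 321 (2003) 1, §7.
[cite: LiebWuPRL1968, eqs. (21)–(23)] [cite: LiebWuPhysicaA2003, §7] -/
theorem lieb_wu_mott_insulator_of_muMinus_tendsto (h₆ : liebWu_muMinus_tendsto) :
    lieb_wu_mott_insulator := by
  intro U hU
  refine ⟨Literature.Analysis.FunctionSpaces.liebWuChargeGap_pos_holds hU, ?_⟩
  have h : Literature.Analysis.FunctionSpaces.liebWuChargeGap U / 2 < Literature.Analysis.FunctionSpaces.liebWuChargeGap U := by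
    linarith [Literature.Analysis.FunctionSpaces.liebWuChargeGap_pos_holds hU]
  exact (lieb_wu_chargeGap_of hubbardChain_groundEnergyAt_particleHole_holds h₆ hU).eventually
    (eventually_gt_nhds h)

/-- The unconditional first half of `lieb_wu_mott_insulator`: for every `U > 0` the Lieb–Wu
charge gap `μ₊ - μ₋` of the half-filled chain is strictly positive (re-export of
`liebWuChargeGap_pos_holds` in the form used by hubbard.S10). Lieb–Wu, PRL 20 (1968) 1445,
discussion after eq. (23). [cite: LiebWuPRL1968, discussion after eq. (23)] -/
theorem lieb_wu_mott_insulator_gap (U : ℝ) (hU : 0 < U) : 0 < Literature.Analysis.FunctionSpaces.liebWuChargeGap U :=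
  Literature.Analysis.FunctionSpaces.liebWuChargeGap_pos_holds hU

/-- The second half of `lieb_wu_mott_insulator` is equivalent, given the (proved) positivity of
the gap, to the statement that the finite-ring charge gaps are eventually `> Δ(U)/2`; in
particular it follows from ANY proof of the convergence of the charge gaps to `Δ(U)`
(part (ii) of `lieb_wu`), with no Bethe-ansatz input on the energy (part (i)).
[cite: LiebWuPRL1968, eqs. (21)–(23)] -/
theorem lieb_wu_mott_insulator_of_tendsto_chargeGap
    (h : ∀ (U : ℝ), 0 < U → Tendsto (fun n : ℕ => chargeGap (hubbardChain (2 * n)) 1 U (2 * n))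
      atTop (𝓝 (Literature.Analysis.FunctionSpaces.liebWuChargeGap U))) :
    lieb_wu_mott_insulator := by
  intro U hU
  refine ⟨Literature.Analysis.FunctionSpaces.liebWuChargeGap_pos_holds hU, ?_⟩
  have h2 : Literature.Analysis.FunctionSpaces.liebWuChargeGap U / 2 < Literature.Analysis.FunctionSpaces.liebWuChargeGap U := by
    linarith [Literature.Analysis.FunctionSpaces.liebWuChargeGap_pos_holds hU]
  exact (h U hU).eventually (eventually_gt_nhds h2)

end Literature.MathematicalPhysics.QuantumLattice
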